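import Literature.InformationTheory.Entropy.VonNeumannEntropyInequalities
import Literature.InformationTheory.Entropy.WeakMonotonicityFromRelEntropy
import Literature.LinearAlgebra.Matrix.HermitianCfcDiagonalForm
import Literature.LinearAlgebra.Matrix.JensenOperatorInequality
import Literature.Probability.Entropy.BinaryRelativeEntropy
import HarnessLib

/-!
# Klein's inequality and the elementary identities of the quantum relative entropy
# (Watrous 2018, §5.2.1–§5.2.2: eq. (5.87), Propositions 5.19 and 5.22, eq. (5.99))

Topic `InformationTheory/Entropy`, namespace `Literature.InformationTheory.Entropy`. Finite-dimensional
quantum systems are complex matrices over a finite index type; the vocabulary is the tree's: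
`vonNeumannEntropy P = H(P) = Σ_j η(λ_j)` (`VonNeumannEntropy.lean`) and
`quantumRelEntropy P Q = D(P‖Q) = Re Tr P(log P − log Q)` (`VonNeumannEntropyInequalities.lean`,
`log = cfc Real.log`, so `log 0 = 0`: the value is Watrous' `D(P‖Q)` of Definition 5.18 exactly when
`im(P) ⊆ im(Q)`; when `im(P) ⊄ im(Q)` the source sets `D = ∞` and the tree's number is a finite junk
value). Accordingly every statement below that needs it carries the SUPPORT HYPOTHESIS
`ker Q ⊆ ker P` in the concrete form `∀ v, Q *ᵥ v = 0 → P *ᵥ v = 0` (automatic for `Q ≻ 0`,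
`ker_le_of_posDef`). Everything is PROVED; no definition, no named fact.

* §1 **Watrous' double-sum formula** [cite: Watrous2018, §5.2.1 eq. (5.87)]: for unitary
  diagonalisations `P = V diag(λ) V⋆`, `Q = W diag(μ) W⋆` (ANY, not only Mathlib's chosen one),
  `D(P‖Q) = Σ_{j,k} |(V⋆W)_{jk}|² λ_j (log λ_j − log μ_k)` (`quantumRelEntropy_eq_sum_sum`,
  `…_eigenvalues`), from `Tr(P f(P)) = Σ_j λ_j f(λ_j)` (`trace_mul_cfc_eq_sum`) and
  `Tr(P g(Q)) = Σ_{j,k} |(V⋆W)_{jk}|² λ_j g(μ_k)` (`trace_mul_cfc_eq_sum_sum`); the commuting case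
  `D(diag p ‖ diag q) = Σ_i p_i (log p_i − log q_i)` (`quantumRelEntropy_diagonal_ofReal`).
* §2 **Klein's inequality** [cite: Watrous2018, Proposition 5.22]: for `P, Q ⪰ 0` with `ker Q ⊆ ker P`,
  the support bookkeeping (5.88) `μ_k = 0 ⟹ λ_j |⟨x_j, y_k⟩|² = 0`
  (`eigenvalue_mul_norm_sq_eq_zero_of_ker_le`), the log-sum bound (5.101)
  `D(P‖Q) ≥ Tr P · log(Tr P / Tr Q) ≥ Tr P − Tr Q` (`sum_sub_sum_le_quantumRelEntropy_and`,
  `trace_mul_log_div_le_quantumRelEntropy`, `re_trace_sub_le_quantumRelEntropy`), hence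
  `Tr Q ≤ Tr P ⟹ D(P‖Q) ≥ 0` (`quantumRelEntropy_nonneg_of_ker_le`, `…_of_posDef`) and, for density
  operators, `D(ρ‖σ) ≥ 0` (`quantumRelEntropy_nonneg`) [cite: NielsenChuang2010, Theorem 11.7] (the special
  case of a density `ρ` against a POSITIVE DEFINITE density `σ` was already in the tree as
  `Literature.Combinatorics.Optimization.Lemma46.quantumRelEntropy_nonneg`, via the Gibbs variational
  principle; not restated). The printed proof is followed: (5.87), then the log-sum
  inequality — Watrous' Lemma 5.4 summed, in the tree as
  `Literature.Probability.Entropy.sum_mul_log_div_le` — on the overlap pairs with `μ_k > 0`.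
* §3 **Scaling** [cite: Watrous2018, §5.2.2 eq. (5.99)]: `D(αP‖βQ) = α D(P‖Q) + α log(α/β) Tr P`
  (`quantumRelEntropy_smul_smul`; (5.98) `H(αP) = αH(P) − α log α · Tr P` is the tree's
  `vonNeumannEntropy_smul`, `ConditionalEntropyConcavity.lean`).
* §4 **Isometric invariance** [cite: Watrous2018, Proposition 5.19 eq. (5.93)]: for an isometry `V`
  (`V⋆V = 𝟙`), `H(VPV⋆) = H(P)` (`P ⪰ 0`, `vonNeumannEntropy_isometry_conj`, by the tree's mirror
  lemma `vonNeumannEntropy_mul_conjTranspose_comm`) and `D(VPV⋆‖VQV⋆) = D(P‖Q)` (`P, Q` Hermitian,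
  `quantumRelEntropy_isometry_conj`, `quantumRelEntropy_unitary_conj`; device
  `V⋆ f(VAV⋆) V = f(A)`, `conjTranspose_mul_cfc_isometry_conj_mul`, from the tree's
  `Literature.LinearAlgebra.Matrix.conjTranspose_mul_cfc_mul_of_isometry`).
* §5 `D(ρ ‖ c𝟙) = −H(ρ) − log c · Tr ρ` and **`D(ρ ‖ 𝟙/d) = log d − H(ρ)`** (`quantumRelEntropy_smul_one`,
  `quantumRelEntropy_uniform`) [cite: Watrous2018, §5.2.3 eq. (5.182)]; with Klein this is
  `H(ρ) ≤ log d`, already in the tree as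
  `Literature.MathematicalPhysics.QuantumLattice.vonNeumannEntropy_le_log_card` (not restated).

## Tree / Mathlib search (2026-08-31)

REUSED, not restated: `quantumRelEntropy`, `re_trace_mul_cfc_log`, `vonNeumannEntropy_eq`
(`VonNeumannEntropyInequalities`, `VonNeumannEntropy`), `vonNeumannEntropy_mul_conjTranspose_comm`
(`WeakMonotonicityFromRelEntropy`), `cfc_sqrt_mul_self` (`RelativeEntropyMonotonicity`),
`cfc_eq_conj_diagonal`, `trace_unitary_conj`, `isHermitian_cfc` (`LinearAlgebra/Matrix/HermitianCfcDiagonalForm`,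
`HermitianAeval`), `conjTranspose_mul_cfc_mul_of_isometry` (`JensenOperatorInequality`),
`sum_mul_log_div_le` (`Probability/Entropy/BinaryRelativeEntropy`). The tree had Klein's inequality only
for POSITIVE DEFINITE pairs (`Literature.MathematicalPhysics.QuantumLattice.trace_sub_trace_le_quantumRelEntropy`,
via the Gibbs variational principle) and for Gibbs densities (`GibbsChordSlackRelEntropy`); `rg` for
`Klein|5\.87|isometry.*Entropy|quantumRelEntropy_nonneg|quantumRelEntropy_eq_sum` over
`Literature/{InformationTheory,LinearAlgebra,MathematicalPhysics/QuantumLattice,Computability/QuantumComplexity}`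
found no statement below. Mathlib: `Matrix.IsHermitian.spectral_theorem`, `eigenvectorUnitary`,
`Matrix.PosDef.dotProduct_mulVec_pos`, `Real.one_sub_inv_le_log_of_pos`, `Finset.sum_filter_of_ne`.

## References

* J. Watrous, *The Theory of Quantum Information* (CUP 2018), §5.2.1 Definitions 5.17–5.18,
  eqs. (5.85)–(5.89); §5.2.2 Propositions 5.19–5.22, eqs. (5.93)–(5.101). [Watrous2018]
* M. A. Nielsen, I. L. Chuang, *Quantum Computation and Quantum Information* (CUP 2010), §11.3.1–11.3.2,
  Theorem 11.7 (Klein's inequality), Theorem 11.8 (2). [NielsenChuang2010]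
-/


noncomputable section

open Matrix
open scoped BigOperators ComplexOrder

namespace Literature.InformationTheory.Entropy

open Literature.Computability.QuantumComplexity (IsDensity)
open Literature.LinearAlgebra.Matrix (cfc_eq_conj_diagonal trace_unitary_conj
  conjTranspose_mul_cfc_mul_of_isometry isHermitian_cfc)

variable {d : Type*} [Fintype d] [DecidableEq d]

/-! ### §1 Traces of `P f(P)` and `P g(Q)` in eigen-coordinates; Watrous' formula (5.87) -/

section DoubleSum

/-- `Tr (P f(P)) = Σ_j λ_j f(λ_j)` for any unitary diagonalisation `P = V diag(λ) V⋆`.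
[cite: Watrous2018, §5.2.1 eq. (5.83)–(5.84)] -/
theorem trace_mul_cfc_eq_sum {P V : Matrix d d ℂ} (hV : V ∈ Matrix.unitaryGroup d ℂ)
    {lam : d → ℝ} (hPV : P = V * diagonal (fun j => ((lam j : ℝ) : ℂ)) * star V) (f : ℝ → ℝ) :
    (P * cfc f P).trace = ((∑ j, lam j * f (lam j) : ℝ) : ℂ) := by
  have h1 : star V * V = 1 := Unitary.star_mul_self_of_mem hV
  have key : P * cfc f P =
      V * (diagonal (fun j => ((lam j : ℝ) : ℂ)) * diagonal (fun j => ((f (lam j) : ℝ) : ℂ))) *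
        star V := by
    rw [cfc_eq_conj_diagonal hV hPV f]
    conv_lhs => rw [hPV]
    simp only [Matrix.mul_assoc]
    rw [← Matrix.mul_assoc (star V) V, h1, Matrix.one_mul]
    rfl
  rw [key, diagonal_mul_diagonal, trace_unitary_conj hV, trace_diagonal]
  push_cast
  rfl

/-- `Tr (P g(Q)) = Σ_{j,k} |⟨x_j, y_k⟩|² λ_j g(μ_k)` for unitary diagonalisations `P = V diag(λ) V⋆`,
`Q = W diag(μ) W⋆` (`x_j`, `y_k` the columns of `V`, `W`; `⟨x_j, y_k⟩ = (V⋆ W)_{jk}`).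
[cite: Watrous2018, §5.2.1 eq. (5.87)] -/
theorem trace_mul_cfc_eq_sum_sum {P Q V W : Matrix d d ℂ} (hV : V ∈ Matrix.unitaryGroup d ℂ)
    (hW : W ∈ Matrix.unitaryGroup d ℂ) {lam mu : d → ℝ}
    (hPV : P = V * diagonal (fun j => ((lam j : ℝ) : ℂ)) * star V)
    (hQW : Q = W * diagonal (fun k => ((mu k : ℝ) : ℂ)) * star W) (g : ℝ → ℝ) :
    (P * cfc g Q).trace =
      ((∑ j, ∑ k, ‖(star V * W) j k‖ ^ 2 * (lam j * g (mu k)) : ℝ) : ℂ) := by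
  have h1 : star V * V = 1 := Unitary.star_mul_self_of_mem hV
  set C : Matrix d d ℂ := star V * W with hC
  have hCstar : star C = star W * V := by rw [hC, star_mul, star_star]
  -- conjugate into the eigenbasis of `P`
  have key : star V * (P * cfc g Q) * star (star V) =
      diagonal (fun j => ((lam j : ℝ) : ℂ)) * C * diagonal (fun k => ((g (mu k) : ℝ) : ℂ)) * star C := by
    rw [star_star, cfc_eq_conj_diagonal hW hQW g, hCstar, hC]
    conv_lhs => rw [hPV]
    simp only [Matrix.mul_assoc]
    rw [← Matrix.mul_assoc (star V) V, h1, Matrix.one_mul]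
    rfl
  rw [← trace_unitary_conj (Unitary.star_mem hV) (P * cfc g Q), key]
  -- entrywise
  rw [Matrix.trace]
  push_cast
  refine Finset.sum_congr rfl fun j _ => ?_
  rw [Matrix.diag_apply, Matrix.mul_apply]
  refine Finset.sum_congr rfl fun k _ => ?_
  simp only [Matrix.mul_diagonal, Matrix.diagonal_mul, Matrix.star_apply]
  have hstar : star (C j k) = (starRingEnd ℂ) (C j k) := rfl
  have hcc : C j k * (starRingEnd ℂ) (C j k) = ((‖C j k‖ ^ 2 : ℝ) : ℂ) := by
    rw [Complex.mul_conj, Complex.normSq_eq_norm_sq]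
  rw [hstar]
  push_cast at hcc ⊢
  linear_combination ((lam j : ℂ) * (g (mu k) : ℂ)) * hcc

/-- Rows of a unitary matrix have unit norm: `Σ_k |C_{jk}|² = 1` (plumbing; public copies of this
folklore identity live in `Literature.LinearAlgebra.Matrix.SymmetricZeroDiagonalSingularValues`). [folklore] -/
private theorem sum_norm_sq_row_eq_one {C : Matrix d d ℂ} (hC : C ∈ Matrix.unitaryGroup d ℂ) (j : d) :
    ∑ k, ‖C j k‖ ^ 2 = 1 := by
  have h : (C * star C) j j = (1 : Matrix d d ℂ) j j := by rw [Unitary.mul_star_self_of_mem hC]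
  rw [Matrix.mul_apply, Matrix.one_apply_eq] at h
  apply Complex.ofReal_injective
  push_cast
  rw [← h]
  refine Finset.sum_congr rfl fun k _ => ?_
  rw [Matrix.star_apply, show star (C j k) = (starRingEnd ℂ) (C j k) from rfl, Complex.mul_conj,
    Complex.normSq_eq_norm_sq]
  push_cast
  rfl

/-- Columns of a unitary matrix have unit norm: `Σ_j |C_{jk}|² = 1` (plumbing, as above). [folklore] -/
private theorem sum_norm_sq_col_eq_one {C : Matrix d d ℂ} (hC : C ∈ Matrix.unitaryGroup d ℂ) (k : d) :
    ∑ j, ‖C j k‖ ^ 2 = 1 := by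
  have h : (star C * C) k k = (1 : Matrix d d ℂ) k k := by rw [Unitary.star_mul_self_of_mem hC]
  rw [Matrix.mul_apply, Matrix.one_apply_eq] at h
  apply Complex.ofReal_injective
  push_cast
  rw [← h]
  refine Finset.sum_congr rfl fun j _ => ?_
  rw [Matrix.star_apply, show star (C j k) = (starRingEnd ℂ) (C j k) from rfl, mul_comm,
    Complex.mul_conj, Complex.normSq_eq_norm_sq]
  push_cast
  rfl

/-- The trace in eigen-coordinates: `Re Tr P = Σ_j λ_j` for a spectral decomposition `P = V diag(λ) V⋆`
(orthonormality of the columns of `V`). [cite: Watrous2018, Corollary 1.4 eq. (1.137)] -/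
theorem re_trace_eq_sum_of_conj_diagonal {P V : Matrix d d ℂ} (hV : V ∈ Matrix.unitaryGroup d ℂ)
    {lam : d → ℝ} (hPV : P = V * diagonal (fun j => ((lam j : ℝ) : ℂ)) * star V) :
    P.trace.re = ∑ j, lam j := by
  rw [hPV, trace_unitary_conj hV, trace_diagonal]
  simp only [Complex.re_sum, Complex.ofReal_re]

/-- **Watrous' double-sum formula for the quantum relative entropy** (general unitary
diagonalisations): if `P = V diag(λ) V⋆` and `Q = W diag(μ) W⋆` then
`D(P‖Q) = Σ_{j,k} |⟨x_j, y_k⟩|² λ_j (log λ_j − log μ_k)`, `⟨x_j, y_k⟩ = (V⋆W)_{jk}` — with the tree's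
conventions (`D = Re Tr P(log P − log Q)`, `log 0 = 0`) the formula holds for ALL Hermitian `P, Q`
(Watrous: "(5.87) … the omission of the indices … is consistent with the identification `0 log 0 = 0`").
[cite: Watrous2018, §5.2.1 eq. (5.87)] -/
theorem quantumRelEntropy_eq_sum_sum {P Q V W : Matrix d d ℂ} (hV : V ∈ Matrix.unitaryGroup d ℂ)
    (hW : W ∈ Matrix.unitaryGroup d ℂ) {lam mu : d → ℝ}
    (hPV : P = V * diagonal (fun j => ((lam j : ℝ) : ℂ)) * star V)
    (hQW : Q = W * diagonal (fun k => ((mu k : ℝ) : ℂ)) * star W) :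
    quantumRelEntropy P Q =
      ∑ j, ∑ k, ‖(star V * W) j k‖ ^ 2 * (lam j * (Real.log (lam j) - Real.log (mu k))) := by
  unfold quantumRelEntropy
  rw [Matrix.mul_sub, Matrix.trace_sub, trace_mul_cfc_eq_sum hV hPV,
    trace_mul_cfc_eq_sum_sum hV hW hPV hQW, ← Complex.ofReal_sub, Complex.ofReal_re,
    ← Finset.sum_sub_distrib]
  refine Finset.sum_congr rfl fun j _ => ?_
  have hrow := sum_norm_sq_row_eq_one (mul_mem (Unitary.star_mem hV) hW) j
  calc lam j * Real.log (lam j) - ∑ k, ‖(star V * W) j k‖ ^ 2 * (lam j * Real.log (mu k))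
      = (∑ k, ‖(star V * W) j k‖ ^ 2) * (lam j * Real.log (lam j)) -
          ∑ k, ‖(star V * W) j k‖ ^ 2 * (lam j * Real.log (mu k)) := by rw [hrow, one_mul]
    _ = ∑ k, (‖(star V * W) j k‖ ^ 2 * (lam j * Real.log (lam j)) -
          ‖(star V * W) j k‖ ^ 2 * (lam j * Real.log (mu k))) := by
        rw [Finset.sum_mul, Finset.sum_sub_distrib]
    _ = _ := Finset.sum_congr rfl fun k _ => by ring

/-- **Watrous' formula (5.87) with Mathlib's spectral data**: for Hermitian `P, Q` with eigenvector
unitaries `V = hP.eigenvectorUnitary`, `W = hQ.eigenvectorUnitary` and eigenvalues `λ, μ`,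
`D(P‖Q) = Σ_{j,k} |(V⋆W)_{jk}|² λ_j (log λ_j − log μ_k)`. [cite: Watrous2018, §5.2.1 eq. (5.87)] -/
theorem quantumRelEntropy_eq_sum_sum_eigenvalues {P Q : Matrix d d ℂ} (hP : P.IsHermitian)
    (hQ : Q.IsHermitian) :
    quantumRelEntropy P Q =
      ∑ j, ∑ k, ‖(star (hP.eigenvectorUnitary : Matrix d d ℂ) *
          (hQ.eigenvectorUnitary : Matrix d d ℂ)) j k‖ ^ 2 *
        (hP.eigenvalues j * (Real.log (hP.eigenvalues j) - Real.log (hQ.eigenvalues k))) :=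
  quantumRelEntropy_eq_sum_sum hP.eigenvectorUnitary.2 hQ.eigenvectorUnitary.2 hP.spectral_theorem
    hQ.spectral_theorem

/-- **Classical (commuting) case**: `D(diag p ‖ diag q) = Σ_i p_i (log p_i − log q_i)` for real
vectors `p, q` — the relative entropy of the tree's `quantumRelEntropy` on diagonal matrices is the
Kullback–Leibler sum (with `log 0 = 0`). [cite: Watrous2018, §5.2.1 (Definition 5.18, extension of the
relative entropy from vectors to operators)] -/
theorem quantumRelEntropy_diagonal_ofReal (p q : d → ℝ) :
    quantumRelEntropy (diagonal fun i => ((p i : ℝ) : ℂ)) (diagonal fun i => ((q i : ℝ) : ℂ)) =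
      ∑ i, p i * (Real.log (p i) - Real.log (q i)) := by
  have h1 : (1 : Matrix d d ℂ) ∈ Matrix.unitaryGroup d ℂ := one_mem _
  have hp : diagonal (fun i => ((p i : ℝ) : ℂ)) = 1 * diagonal (fun i => ((p i : ℝ) : ℂ)) * star 1 := by
    rw [Matrix.one_mul, star_one, Matrix.mul_one]
  have hq : diagonal (fun i => ((q i : ℝ) : ℂ)) = 1 * diagonal (fun i => ((q i : ℝ) : ℂ)) * star 1 := by
    rw [Matrix.one_mul, star_one, Matrix.mul_one]
  rw [quantumRelEntropy_eq_sum_sum h1 h1 hp hq]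
  refine Finset.sum_congr rfl fun j _ => ?_
  rw [star_one, Matrix.one_mul, Finset.sum_eq_single_of_mem j (Finset.mem_univ _)]
  · rw [Matrix.one_apply_eq, norm_one, one_pow, one_mul]
  · intro k _ hkj
    rw [Matrix.one_apply_ne (Ne.symm hkj), norm_zero, zero_pow two_ne_zero, zero_mul]

end DoubleSum

/-! ### §2 Klein's inequality (Watrous Proposition 5.22) -/

section Klein

/-- **Support bookkeeping.** If `ker Q ⊆ ker P` (i.e. `im P ⊆ im Q` for Hermitian matrices) then,
in eigen-coordinates `P = V diag(λ) V⋆`, `Q = W diag(μ) W⋆`, every overlap weight on a kernel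
direction of `Q` vanishes: `μ_k = 0 ⟹ λ_j |⟨x_j, y_k⟩|² = 0`.
[cite: Watrous2018, §5.2.1 eq. (5.88)] -/
theorem eigenvalue_mul_norm_sq_eq_zero_of_ker_le {P Q V W : Matrix d d ℂ}
    (hV : V ∈ Matrix.unitaryGroup d ℂ) (hW : W ∈ Matrix.unitaryGroup d ℂ) {lam mu : d → ℝ}
    (hPV : P = V * diagonal (fun j => ((lam j : ℝ) : ℂ)) * star V)
    (hQW : Q = W * diagonal (fun k => ((mu k : ℝ) : ℂ)) * star W)
    (hker : ∀ v : d → ℂ, Q *ᵥ v = 0 → P *ᵥ v = 0) {k : d} (hk : mu k = 0) (j : d) :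
    lam j * ‖(star V * W) j k‖ ^ 2 = 0 := by
  have h1 : star V * V = 1 := Unitary.star_mul_self_of_mem hV
  set w : d → ℂ := fun i => W i k with hw
  -- `w = y_k` is a kernel vector of `Q`
  have hQWmul : Q * W = W * diagonal (fun k => ((mu k : ℝ) : ℂ)) := by
    rw [hQW, Matrix.mul_assoc (W * _), Unitary.star_mul_self_of_mem hW, Matrix.mul_one]
  have hQw : Q *ᵥ w = 0 := by
    funext i
    have h : (Q * W) i k = (W * diagonal (fun k => ((mu k : ℝ) : ℂ))) i k := by rw [hQWmul]
    rw [Matrix.mul_apply, Matrix.mul_diagonal, hk, Complex.ofReal_zero, mul_zero] at h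
    simpa [Matrix.mulVec, dotProduct, hw] using h
  have hPw : P *ᵥ w = 0 := hker w hQw
  -- read `P w = 0` in the eigenbasis of `P`
  have hVP : star V * P = diagonal (fun j => ((lam j : ℝ) : ℂ)) * star V := by
    rw [hPV, ← Matrix.mul_assoc, ← Matrix.mul_assoc, h1, Matrix.one_mul]
  have h3 : (diagonal (fun j => ((lam j : ℝ) : ℂ)) * star V) *ᵥ w = 0 := by
    rw [← hVP, ← Matrix.mulVec_mulVec, hPw, Matrix.mulVec_zero]
  have h4 := congrFun h3 j
  rw [← Matrix.mulVec_mulVec, Matrix.mulVec_diagonal, Pi.zero_apply] at h4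
  have h5 : (star V *ᵥ w) j = (star V * W) j k := by
    simp [Matrix.mulVec, dotProduct, Matrix.mul_apply, hw]
  rw [h5] at h4
  rcases mul_eq_zero.1 h4 with h | h
  · rw [Complex.ofReal_eq_zero.1 h, zero_mul]
  · rw [h, norm_zero, zero_pow two_ne_zero, mul_zero]

/-- **Klein's inequality in log-sum form** (Watrous (5.101): `D(P‖Q) ≥ θ(Tr P, Tr Q)`), general
eigen-coordinates: for `P = V diag(λ) V⋆ ⪰ 0`, `Q = W diag(μ) W⋆ ⪰ 0` with `ker Q ⊆ ker P`,
(i) `Σλ − Σμ ≤ D(P‖Q)`, and (ii) if `Σμ > 0` then `(Σλ) log(Σλ / Σμ) ≤ D(P‖Q)`. Proof as printed: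
the double sum (5.87) restricted to the overlap pairs with `μ_k > 0` is a sum `Σ a log(a/b)` with
`Σ a = Tr P`, `Σ b ≤ Tr Q`, and the log-sum inequality (the tree's
`Literature.Probability.Entropy.sum_mul_log_div_le`, Watrous' Lemma 5.4 iterated) bounds it below.
[cite: Watrous2018, Proposition 5.22 (proof, eq. (5.101)) and Lemma 5.4] -/
theorem sum_sub_sum_le_quantumRelEntropy_and {P Q V W : Matrix d d ℂ}
    (hV : V ∈ Matrix.unitaryGroup d ℂ) (hW : W ∈ Matrix.unitaryGroup d ℂ) {lam mu : d → ℝ}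
    (hPV : P = V * diagonal (fun j => ((lam j : ℝ) : ℂ)) * star V)
    (hQW : Q = W * diagonal (fun k => ((mu k : ℝ) : ℂ)) * star W)
    (hlam : ∀ j, 0 ≤ lam j) (hmu : ∀ k, 0 ≤ mu k)
    (hker : ∀ v : d → ℂ, Q *ᵥ v = 0 → P *ᵥ v = 0) :
    (∑ j, lam j) - (∑ k, mu k) ≤ quantumRelEntropy P Q ∧
      (0 < ∑ k, mu k → (∑ j, lam j) * Real.log ((∑ j, lam j) / ∑ k, mu k) ≤ quantumRelEntropy P Q) := by
  classical
  -- overlap weights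
  set c : d → d → ℝ := fun j k => ‖(star V * W) j k‖ ^ 2 with hc
  have hc0 : ∀ j k, 0 ≤ c j k := fun j k => by positivity
  have hCu : star V * W ∈ Matrix.unitaryGroup d ℂ := mul_mem (Unitary.star_mem hV) hW
  have hrow : ∀ j, ∑ k, c j k = 1 := fun j => sum_norm_sq_row_eq_one hCu j
  have hcol : ∀ k, ∑ j, c j k = 1 := fun k => sum_norm_sq_col_eq_one hCu k
  have hvan : ∀ j k, mu k = 0 → lam j * c j k = 0 := fun j k hk =>
    eigenvalue_mul_norm_sq_eq_zero_of_ker_le hV hW hPV hQW hker hk j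
  -- the terms, as functions on `d × d`
  set a : d × d → ℝ := fun p => c p.1 p.2 * lam p.1 with ha
  set b : d × d → ℝ := fun p => c p.1 p.2 * mu p.2 with hb
  set t : d × d → ℝ := fun p => c p.1 p.2 * (lam p.1 * (Real.log (lam p.1) - Real.log (mu p.2)))
    with ht
  set T : Finset (d × d) := (Finset.univ ×ˢ Finset.univ).filter (fun p => 0 < c p.1 p.2 ∧ 0 < mu p.2)
    with hT
  have hD : quantumRelEntropy P Q = ∑ p ∈ Finset.univ ×ˢ Finset.univ, t p := by
    rw [quantumRelEntropy_eq_sum_sum hV hW hPV hQW, Finset.sum_product]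
  -- off `T` every term vanishes
  have hoff : ∀ p ∈ Finset.univ ×ˢ (Finset.univ : Finset d), ¬ (0 < c p.1 p.2 ∧ 0 < mu p.2) →
      lam p.1 * c p.1 p.2 = 0 := by
    rintro ⟨j, k⟩ _ hnot
    by_cases hcjk : 0 < c j k
    · have hmk : mu k = 0 := le_antisymm (not_lt.1 fun h => hnot ⟨hcjk, h⟩) (hmu k)
      exact hvan j k hmk
    · have : c j k = 0 := le_antisymm (not_lt.1 hcjk) (hc0 j k)
      simp [this]
  have hDT : quantumRelEntropy P Q = ∑ p ∈ T, a p * Real.log (a p / b p) := by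
    rw [hD, ← Finset.sum_filter_of_ne (p := fun p => 0 < c p.1 p.2 ∧ 0 < mu p.2)]
    · refine Finset.sum_congr rfl fun p hp => ?_
      obtain ⟨hcp, hmp⟩ := (Finset.mem_filter.1 hp).2
      simp only [ht, ha, hb]
      rw [mul_div_mul_left _ _ (ne_of_gt hcp)]
      rcases (hlam p.1).eq_or_lt with h0 | hpos
      · rw [← h0]; simp
      · rw [Real.log_div (ne_of_gt hpos) (ne_of_gt hmp)]; ring
    · intro p hp hne
      by_contra hnot
      apply hne
      have h0 := hoff p hp hnot
      simp only [ht]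
      calc c p.1 p.2 * (lam p.1 * (Real.log (lam p.1) - Real.log (mu p.2)))
          = (lam p.1 * c p.1 p.2) * (Real.log (lam p.1) - Real.log (mu p.2)) := by ring
        _ = 0 := by rw [h0, zero_mul]
  -- the log-sum inequality on `T`
  have haT : ∀ p ∈ T, 0 ≤ a p := fun p _ => mul_nonneg (hc0 _ _) (hlam _)
  have hbT : ∀ p ∈ T, 0 < b p := fun p hp =>
    mul_pos (Finset.mem_filter.1 hp).2.1 (Finset.mem_filter.1 hp).2.2
  have hLS := Literature.Probability.Entropy.sum_mul_log_div_le T a b haT hbT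
  -- `Σ_T a = Tr P`
  have hAT : ∑ p ∈ T, a p = ∑ j, lam j := by
    rw [hT, Finset.sum_filter_of_ne, Finset.sum_product]
    · refine Finset.sum_congr rfl fun j _ => ?_
      simp only [ha]
      rw [← Finset.sum_mul, hrow j, one_mul]
    · intro p hp hne
      by_contra hnot
      apply hne
      simp only [ha]
      rw [mul_comm]
      exact hoff p hp hnot
  -- `Σ_T b ≤ Tr Q`
  have hBT : ∑ p ∈ T, b p ≤ ∑ k, mu k := by
    calc ∑ p ∈ T, b p ≤ ∑ p ∈ Finset.univ ×ˢ (Finset.univ : Finset d), b p :=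
          Finset.sum_le_sum_of_subset_of_nonneg (Finset.filter_subset _ _)
            (fun p _ _ => mul_nonneg (hc0 _ _) (hmu _))
      _ = ∑ k, mu k := by
          rw [Finset.sum_product_right]
          refine Finset.sum_congr rfl fun k _ => ?_
          simp only [hb]
          rw [← Finset.sum_mul, hcol k, one_mul]
  -- elementary: `A log(A/B) ≥ A − B`
  have hlog : ∀ {A B : ℝ}, 0 ≤ A → 0 < B → A - B ≤ A * Real.log (A / B) := by
    intro A B hA hB
    rcases hA.eq_or_lt with hA0 | hApos
    · rw [← hA0]; simp [hB.le]
    · have h := Real.one_sub_inv_le_log_of_pos (div_pos hApos hB)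
      rw [inv_div] at h
      have h2 : A * (1 - B / A) = A - B := by field_simp
      calc A - B = A * (1 - B / A) := h2.symm
        _ ≤ A * Real.log (A / B) := mul_le_mul_of_nonneg_left h hApos.le
  have hA0 : 0 ≤ ∑ j, lam j := Finset.sum_nonneg fun j _ => hlam j
  have hmu0 : 0 ≤ ∑ k, mu k := Finset.sum_nonneg fun k _ => hmu k
  rcases T.eq_empty_or_nonempty with hTe | hTne
  · -- no overlap pair at all: `D = 0`, `Tr P = 0`
    have hD0 : quantumRelEntropy P Q = 0 := by rw [hDT, hTe, Finset.sum_empty]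
    have hA : ∑ j, lam j = 0 := by rw [← hAT, hTe, Finset.sum_empty]
    refine ⟨by rw [hD0, hA]; linarith, fun _ => by rw [hD0, hA, zero_mul]⟩
  · have hBpos : 0 < ∑ p ∈ T, b p := Finset.sum_pos hbT hTne
    rw [hAT] at hLS
    refine ⟨?_, fun hmupos => ?_⟩
    · calc (∑ j, lam j) - ∑ k, mu k ≤ (∑ j, lam j) - ∑ p ∈ T, b p := by linarith
        _ ≤ (∑ j, lam j) * Real.log ((∑ j, lam j) / ∑ p ∈ T, b p) := hlog hA0 hBpos
        _ ≤ quantumRelEntropy P Q := by rw [hDT]; exact hLS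
    · rcases hA0.eq_or_lt with hAz | hApos
      · rw [← hAz, zero_mul, hDT]
        calc (0 : ℝ) = (∑ j, lam j) * Real.log ((∑ j, lam j) / ∑ p ∈ T, b p) := by
              rw [← hAz, zero_mul]
          _ ≤ _ := hLS
      · calc (∑ j, lam j) * Real.log ((∑ j, lam j) / ∑ k, mu k)
            ≤ (∑ j, lam j) * Real.log ((∑ j, lam j) / ∑ p ∈ T, b p) :=
              mul_le_mul_of_nonneg_left (Real.log_le_log (div_pos hApos hmupos)
                (div_le_div_of_nonneg_left hApos.le hBpos hBT)) hApos.le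
          _ ≤ quantumRelEntropy P Q := by rw [hDT]; exact hLS

omit [DecidableEq d] in
/-- For a positive definite `Q` the support hypothesis `ker Q ⊆ ker P` is automatic: a positive definite
operator is invertible, so `ker Q = 0`. [cite: Watrous2018, §1.1.2 item 4 (positive definite = positive
semidefinite and invertible)] -/
theorem ker_le_of_posDef {P Q : Matrix d d ℂ} (hQ : Q.PosDef) :
    ∀ v : d → ℂ, Q *ᵥ v = 0 → P *ᵥ v = 0 := by
  intro v hv
  by_cases h : v = 0
  · rw [h, Matrix.mulVec_zero]
  · have hpos := hQ.dotProduct_mulVec_pos h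
    rw [hv, dotProduct_zero] at hpos
    exact absurd hpos (lt_irrefl 0)

/-- **Klein's inequality, unnormalised form** (Tropp's "`D(X;Y) = Tr(X log X − X log Y − (X − Y)) ≥ 0`";
Watrous (5.101) with `θ(α, β) ≥ α − β`): for `P, Q ⪰ 0` with `ker Q ⊆ ker P`,
`Re Tr P − Re Tr Q ≤ D(P‖Q)`. Generalises the tree's positive definite
`Literature.MathematicalPhysics.QuantumLattice.trace_sub_trace_le_quantumRelEntropy`.
[cite: Watrous2018, Proposition 5.22 (proof, eq. (5.101))] -/
theorem re_trace_sub_le_quantumRelEntropy {P Q : Matrix d d ℂ} (hP : P.PosSemidef) (hQ : Q.PosSemidef)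
    (hker : ∀ v : d → ℂ, Q *ᵥ v = 0 → P *ᵥ v = 0) :
    P.trace.re - Q.trace.re ≤ quantumRelEntropy P Q := by
  have h := (sum_sub_sum_le_quantumRelEntropy_and hP.1.eigenvectorUnitary.2
    hQ.1.eigenvectorUnitary.2 hP.1.spectral_theorem hQ.1.spectral_theorem hP.eigenvalues_nonneg
    hQ.eigenvalues_nonneg hker).1
  rwa [← re_trace_eq_sum_of_conj_diagonal hP.1.eigenvectorUnitary.2 hP.1.spectral_theorem,
    ← re_trace_eq_sum_of_conj_diagonal hQ.1.eigenvectorUnitary.2 hQ.1.spectral_theorem] at h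

/-- **Klein's inequality** (Watrous Proposition 5.22): for `P, Q ⪰ 0` with `Tr P ≥ Tr Q` — and
`im P ⊆ im Q`, the case in which `D(P‖Q) < ∞` in the source's convention (5.85); otherwise the printed
inequality is `∞ ≥ 0` — one has `D(P‖Q) ≥ 0`. [cite: Watrous2018, Proposition 5.22] -/
theorem quantumRelEntropy_nonneg_of_ker_le {P Q : Matrix d d ℂ} (hP : P.PosSemidef)
    (hQ : Q.PosSemidef) (hker : ∀ v : d → ℂ, Q *ᵥ v = 0 → P *ᵥ v = 0)
    (htr : Q.trace.re ≤ P.trace.re) : 0 ≤ quantumRelEntropy P Q := by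
  linarith [re_trace_sub_le_quantumRelEntropy hP hQ hker]

/-- **Klein's inequality, log-sum form** `D(P‖Q) ≥ θ(Tr P, Tr Q) = Tr P · log(Tr P / Tr Q)` for
`P, Q ⪰ 0`, `ker Q ⊆ ker P`, `Tr Q > 0`. [cite: Watrous2018, Proposition 5.22 (proof, eq. (5.101))] -/
theorem trace_mul_log_div_le_quantumRelEntropy {P Q : Matrix d d ℂ} (hP : P.PosSemidef)
    (hQ : Q.PosSemidef) (hker : ∀ v : d → ℂ, Q *ᵥ v = 0 → P *ᵥ v = 0) (hQtr : 0 < Q.trace.re) :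
    P.trace.re * Real.log (P.trace.re / Q.trace.re) ≤ quantumRelEntropy P Q := by
  have h := (sum_sub_sum_le_quantumRelEntropy_and hP.1.eigenvectorUnitary.2
    hQ.1.eigenvectorUnitary.2 hP.1.spectral_theorem hQ.1.spectral_theorem hP.eigenvalues_nonneg
    hQ.eigenvalues_nonneg hker).2
  rw [← re_trace_eq_sum_of_conj_diagonal hP.1.eigenvectorUnitary.2 hP.1.spectral_theorem,
    ← re_trace_eq_sum_of_conj_diagonal hQ.1.eigenvectorUnitary.2 hQ.1.spectral_theorem] at h
  exact h hQtr

/-- Klein's inequality with a positive definite reference operator: `P ⪰ 0`, `Q ≻ 0`,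
`Tr Q ≤ Tr P` ⟹ `D(P‖Q) ≥ 0`. [cite: Watrous2018, Proposition 5.22] -/
theorem quantumRelEntropy_nonneg_of_posDef {P Q : Matrix d d ℂ} (hP : P.PosSemidef) (hQ : Q.PosDef)
    (htr : Q.trace.re ≤ P.trace.re) : 0 ≤ quantumRelEntropy P Q :=
  quantumRelEntropy_nonneg_of_ker_le hP hQ.posSemidef (ker_le_of_posDef hQ) htr

/-- **Klein's inequality for density operators** ("In particular, `D(ρ‖σ) ≥ 0` for every choice of
density operators"): for densities `ρ, σ` with `im ρ ⊆ im σ`, `0 ≤ D(ρ‖σ)`.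
[cite: Watrous2018, Proposition 5.22] [cite: NielsenChuang2010, Theorem 11.7] -/
theorem quantumRelEntropy_nonneg {ρ σ : Matrix d d ℂ} (hρ : IsDensity ρ) (hσ : IsDensity σ)
    (hker : ∀ v : d → ℂ, σ *ᵥ v = 0 → ρ *ᵥ v = 0) : 0 ≤ quantumRelEntropy ρ σ :=
  quantumRelEntropy_nonneg_of_ker_le hρ.1 hσ.1 hker (by rw [hρ.2, hσ.2])

end Klein

/-! ### §3 Scaling: Watrous (5.99) -/

section Scaling

/-- Scaling a unitary diagonalisation: `αP = V diag(αλ) V⋆` (plumbing). [folklore] -/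
private theorem smul_eq_conj_diagonal {P V : Matrix d d ℂ} {lam : d → ℝ}
    (hPV : P = V * diagonal (fun j => ((lam j : ℝ) : ℂ)) * star V) (α : ℝ) :
    ((α : ℝ) : ℂ) • P = V * diagonal (fun j => ((α * lam j : ℝ) : ℂ)) * star V := by
  have hd : diagonal (fun j => ((α * lam j : ℝ) : ℂ)) = ((α : ℝ) : ℂ) • diagonal (fun j => ((lam j : ℝ) : ℂ)) := by
    rw [← diagonal_smul]
    congr 1
    funext j
    simp
  rw [hPV, hd, mul_smul_comm, smul_mul_assoc]

/-- **Watrous (5.99)**: `D(αP ‖ βQ) = α D(P‖Q) + α log(α/β) Tr P` for `α, β > 0`, `P, Q ⪰ 0` with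
`im P ⊆ im Q` (with the tree's `log 0 = 0` convention the support hypothesis is what makes
`Tr(αP · log(βQ)) = Tr(αP · log Q) + log β · Tr P`). [cite: Watrous2018, §5.2.2 eq. (5.99)] -/
theorem quantumRelEntropy_smul_smul {P Q : Matrix d d ℂ} (hP : P.PosSemidef) (hQ : Q.PosSemidef)
    (hker : ∀ v : d → ℂ, Q *ᵥ v = 0 → P *ᵥ v = 0) {α β : ℝ} (hα : 0 < α) (hβ : 0 < β) :
    quantumRelEntropy (((α : ℝ) : ℂ) • P) (((β : ℝ) : ℂ) • Q) =
      α * quantumRelEntropy P Q + α * Real.log (α / β) * P.trace.re := by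
  set V : Matrix d d ℂ := (hP.1.eigenvectorUnitary : Matrix d d ℂ) with hV
  set W : Matrix d d ℂ := (hQ.1.eigenvectorUnitary : Matrix d d ℂ) with hW
  have hVu : V ∈ Matrix.unitaryGroup d ℂ := hP.1.eigenvectorUnitary.2
  have hWu : W ∈ Matrix.unitaryGroup d ℂ := hQ.1.eigenvectorUnitary.2
  have hPV : P = V * diagonal (fun j => ((hP.1.eigenvalues j : ℝ) : ℂ)) * star V :=
    hP.1.spectral_theorem
  have hQW : Q = W * diagonal (fun k => ((hQ.1.eigenvalues k : ℝ) : ℂ)) * star W :=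
    hQ.1.spectral_theorem
  rw [quantumRelEntropy_eq_sum_sum hVu hWu (smul_eq_conj_diagonal hPV α) (smul_eq_conj_diagonal hQW β),
    quantumRelEntropy_eq_sum_sum hVu hWu hPV hQW, re_trace_eq_sum_of_conj_diagonal hVu hPV]
  set c : d → d → ℝ := fun j k => ‖(star V * W) j k‖ ^ 2 with hc
  have hrow : ∀ j, ∑ k, c j k = 1 := fun j =>
    sum_norm_sq_row_eq_one (mul_mem (Unitary.star_mem hVu) hWu) j
  have hvan : ∀ j k, hQ.1.eigenvalues k = 0 → hP.1.eigenvalues j * c j k = 0 := fun j k hk =>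
    eigenvalue_mul_norm_sq_eq_zero_of_ker_le hVu hWu hPV hQW hker hk j
  -- termwise identity
  have hterm : ∀ j k, c j k * (α * hP.1.eigenvalues j *
      (Real.log (α * hP.1.eigenvalues j) - Real.log (β * hQ.1.eigenvalues k))) =
      α * (c j k * (hP.1.eigenvalues j * (Real.log (hP.1.eigenvalues j) - Real.log (hQ.1.eigenvalues k))))
        + α * Real.log (α / β) * (c j k * hP.1.eigenvalues j) := by
    intro j k
    rcases (hP.eigenvalues_nonneg j).eq_or_lt with hl0 | hlpos
    · rw [← hl0]; simp
    rcases (hQ.eigenvalues_nonneg k).eq_or_lt with hm0 | hmpos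
    · have hc0 : c j k = 0 := by
        have := hvan j k hm0.symm
        rcases mul_eq_zero.1 this with h | h
        · exact absurd h (ne_of_gt hlpos)
        · exact h
      rw [hc0]; simp
    rw [Real.log_mul (ne_of_gt hα) (ne_of_gt hlpos), Real.log_mul (ne_of_gt hβ) (ne_of_gt hmpos),
      Real.log_div (ne_of_gt hα) (ne_of_gt hβ)]
    ring
  simp_rw [show ∀ j k, ‖(star V * W) j k‖ ^ 2 = c j k from fun j k => rfl, hterm,
    Finset.sum_add_distrib, ← Finset.mul_sum]
  have hsum : ∑ j, ∑ k, c j k * hP.1.eigenvalues j = ∑ j, hP.1.eigenvalues j :=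
    Finset.sum_congr rfl fun j _ => by rw [← Finset.sum_mul, hrow j, one_mul]
  rw [hsum]

end Scaling

/-! ### §4 Isometric invariance (Watrous Proposition 5.19) -/

section Isometry

variable {p : Type*} [Fintype p] [DecidableEq p]

/-- **`H(VPV⋆) = H(P)` for an isometry `V`** (`V⋆V = 𝟙`) and `P ⪰ 0`: with `P = R²`, `R = √P`,
`VPV⋆ = (VR)(VR)⋆` and `(VR)⋆(VR) = P` have the same entropy (the tree's mirror lemma
`vonNeumannEntropy_mul_conjTranspose_comm`). [cite: Watrous2018, Proposition 5.19 eq. (5.93)] -/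
theorem vonNeumannEntropy_isometry_conj (V : Matrix p d ℂ) (hV : Vᴴ * V = 1) {P : Matrix d d ℂ}
    (hP : P.PosSemidef) : vonNeumannEntropy (V * P * Vᴴ) = vonNeumannEntropy P := by
  set R : Matrix d d ℂ := cfc Real.sqrt P with hR
  have hRR : R * R = P := cfc_sqrt_mul_self hP
  have hRh : Rᴴ = R := isHermitian_cfc P Real.sqrt
  have h1 : V * P * Vᴴ = (V * R) * (V * R)ᴴ := by
    rw [conjTranspose_mul, hRh, ← hRR]
    simp only [Matrix.mul_assoc]
  rw [h1, vonNeumannEntropy_mul_conjTranspose_comm, conjTranspose_mul, hRh, Matrix.mul_assoc,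
    ← Matrix.mul_assoc Vᴴ V R, hV, Matrix.one_mul, hRR]

/-- Compression of a function of `VAV⋆` back along the isometry: `V⋆ f(VAV⋆) V = f(A)`.
[cite: Watrous2018, Proposition 5.19 (proof device)] -/
theorem conjTranspose_mul_cfc_isometry_conj_mul (V : Matrix p d ℂ) (hV : Vᴴ * V = 1)
    {A : Matrix d d ℂ} (hA : A.IsHermitian) (f : ℝ → ℝ) :
    Vᴴ * cfc f (V * A * Vᴴ) * V = cfc f A := by
  have hX : (V * A * Vᴴ).IsHermitian := isHermitian_mul_mul_conjTranspose V hA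
  have hcomm : V * A * Vᴴ * (V * Vᴴ) = V * Vᴴ * (V * A * Vᴴ) := by
    simp only [Matrix.mul_assoc]
    rw [← Matrix.mul_assoc Vᴴ V Vᴴ, hV, Matrix.one_mul, ← Matrix.mul_assoc Vᴴ V (A * Vᴴ), hV,
      Matrix.one_mul]
  rw [conjTranspose_mul_cfc_mul_of_isometry V hV hX hcomm f]
  congr 1
  simp only [Matrix.mul_assoc]
  rw [← Matrix.mul_assoc Vᴴ V (A * (Vᴴ * V)), hV, Matrix.one_mul, Matrix.mul_one]

/-- **`D(VPV⋆ ‖ VQV⋆) = D(P‖Q)` for an isometry `V`** and Hermitian `P, Q`.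
[cite: Watrous2018, Proposition 5.19 eq. (5.93)] -/
theorem quantumRelEntropy_isometry_conj (V : Matrix p d ℂ) (hV : Vᴴ * V = 1) {P Q : Matrix d d ℂ}
    (hP : P.IsHermitian) (hQ : Q.IsHermitian) :
    quantumRelEntropy (V * P * Vᴴ) (V * Q * Vᴴ) = quantumRelEntropy P Q := by
  have htr : ∀ F : Matrix p p ℂ, (V * P * Vᴴ * F).trace = (P * (Vᴴ * F * V)).trace := fun F => by
    rw [show V * P * Vᴴ * F = V * (P * Vᴴ * F) by simp only [Matrix.mul_assoc], Matrix.trace_mul_comm]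
    simp only [Matrix.mul_assoc]
  unfold quantumRelEntropy
  rw [Matrix.mul_sub, Matrix.mul_sub, Matrix.trace_sub, Matrix.trace_sub, htr, htr,
    conjTranspose_mul_cfc_isometry_conj_mul V hV hP, conjTranspose_mul_cfc_isometry_conj_mul V hV hQ]

/-- Unitary invariance: `D(UPU⋆ ‖ UQU⋆) = D(P‖Q)` for `U` unitary, `P, Q` Hermitian.
[cite: Watrous2018, Proposition 5.19 eq. (5.93)] -/
theorem quantumRelEntropy_unitary_conj {U : Matrix d d ℂ} (hU : U ∈ Matrix.unitaryGroup d ℂ)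
    {P Q : Matrix d d ℂ} (hP : P.IsHermitian) (hQ : Q.IsHermitian) :
    quantumRelEntropy (U * P * star U) (U * Q * star U) = quantumRelEntropy P Q := by
  have hU' : Uᴴ * U = 1 := Unitary.star_mul_self_of_mem hU
  exact quantumRelEntropy_isometry_conj U hU' hP hQ

end Isometry

/-! ### §5 Relative entropy to a multiple of the identity; the completely mixed state -/

section Uniform

/-- `f(c𝟙) = f(c)𝟙` (plumbing; a public copy is `Literature.Analysis.Complex.cfc_smul_one`). [folklore] -/
private theorem cfc_smul_one (c : ℝ) (f : ℝ → ℝ) :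
    cfc f (((c : ℝ) : ℂ) • (1 : Matrix d d ℂ)) = ((f c : ℝ) : ℂ) • (1 : Matrix d d ℂ) := by
  have h1 : (1 : Matrix d d ℂ) ∈ Matrix.unitaryGroup d ℂ := one_mem _
  have h : ((c : ℝ) : ℂ) • (1 : Matrix d d ℂ) =
      1 * diagonal (fun _ : d => ((c : ℝ) : ℂ)) * star (1 : Matrix d d ℂ) := by
    rw [Matrix.one_mul, star_one, Matrix.mul_one, Matrix.smul_one_eq_diagonal]
  rw [cfc_eq_conj_diagonal h1 h f, Matrix.one_mul, star_one, Matrix.mul_one, Matrix.smul_one_eq_diagonal]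
  rfl

/-- `D(ρ ‖ c𝟙) = −S(ρ) − log c · Re Tr ρ` for Hermitian `ρ` and real `c`
(`Tr ρ log ρ = −S(ρ)`). [cite: Watrous2018, §5.2.3 eq. (5.182) (with trivial `Y, Z`)]
[cite: NielsenChuang2010, §11.3.2 eq. (11.58) neighbourhood (`S(ρ‖I/d) = log d − S(ρ)`)] -/
theorem quantumRelEntropy_smul_one {ρ : Matrix d d ℂ} (hρ : ρ.IsHermitian) (c : ℝ) :
    quantumRelEntropy ρ (((c : ℝ) : ℂ) • (1 : Matrix d d ℂ)) =
      - vonNeumannEntropy ρ - Real.log c * ρ.trace.re := by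
  unfold quantumRelEntropy
  rw [cfc_smul_one, Matrix.mul_sub, Matrix.trace_sub, Complex.sub_re, re_trace_mul_cfc_log hρ,
    Matrix.mul_smul, Matrix.mul_one, Matrix.trace_smul, smul_eq_mul, Complex.re_ofReal_mul]

/-- **The relative entropy to the completely mixed state**: `D(ρ ‖ 𝟙/d) = log d − S(ρ)` for a
unit-trace Hermitian `ρ` on a `d`-dimensional space. (Klein's inequality then gives `S(ρ) ≤ log d`,
in the tree as `Literature.MathematicalPhysics.QuantumLattice.vonNeumannEntropy_le_log_card`.)
[cite: Watrous2018, §5.2.3 eq. (5.182)] [cite: NielsenChuang2010, Theorem 11.8 (2) (proof)] -/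
theorem quantumRelEntropy_uniform [Nonempty d] {ρ : Matrix d d ℂ} (hρ : ρ.IsHermitian)
    (htr : ρ.trace = 1) :
    quantumRelEntropy ρ ((((Fintype.card d : ℝ)⁻¹ : ℝ) : ℂ) • (1 : Matrix d d ℂ)) =
      Real.log (Fintype.card d) - vonNeumannEntropy ρ := by
  rw [quantumRelEntropy_smul_one hρ, htr, Complex.one_re, mul_one, Real.log_inv]
  ring

end Uniform

end Literature.InformationTheory.Entropy
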